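import Summits.BirchSwinnertonDyer.Rank1Residual.ManinAdditive.ThreeShiftBase
import Literature.NumberTheory.EllipticCurves.Gamma0AwayCharacterExtensionProofs
import HarnessLib

/-!
# E-es-107 PROVED: Serre's amalgam for `Γ₀(N; ℤ[1/3])` in Hom-form, hence the t = 3 BASE E-es-102
# `ThreeShiftBasePrimeToThree` (`K₃(N₀) = D(N₀)`, `K₃⁻(N₀) = 0` for `3 ∤ N₀`) UNCONDITIONALLY

Cell `bsd-f2-manin`, seat `bsd-line-manin23-p2` (gen 12), route `ManinLocalTwoThree`, bears on crux C3
`ManinPrimeToThreeAtNine` (stmt-BirchSwinnertonDyer-22968).  BSD is not proved by this; Manin's conjecture is not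
proved by this; C3 stays OPEN.

The typer's file `Summits/BirchSwinnertonDyer/Rank1Residual/ManinAdditive/ThreeShiftBase.lean` (T-es-33, p680134) types the
single printed input of the es-chain's base node as the `@[conjecture]` obligation
`NineShiftEqualiser.ThreeShiftAmalgamExtensionAll` (E-es-107: for `3 ∤ N`, two additive maps `φ₁, φ₂ : Γ₀(N) → K`
into an abelian group which are compatible along the two embeddings `Γ₀(3N) ⇉ Γ₀(N)` — inclusion and
`γ ↦ diag(3,1) γ diag(3,1)⁻¹` — are the restrictions along `ι` and `κ = Ad(diag(3,1)⁻¹) ∘ ι` of ONE map `Φ` on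
`SL₂(ℤ[1/3])` additive on `Δ₃(N) = Γ₀(N; ℤ[1/3])`), and proves the edge
`threeShiftBasePrimeToThree_of_amalgam : ThreeShiftAmalgamExtensionAll → ThreeShiftBasePrimeToThree`.

THIS FILE DISCHARGES E-es-107 (`threeShiftAmalgamExtensionAll_holds`) and hence E-es-102
(`threeShiftBasePrimeToThree_holds`).  No new mathematics is needed: the Literature already holds the whole
tree-free proof of Serre's theorem for `Γ₀(L′; ℤ[1/t])`, built for the SYMMETRIC special case `φ₁ = φ₂` into a
field (named fact `gamma0Away_character_extension_of_shiftInvariant`, discharged in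
`Literature/NumberTheory/EllipticCurves/Gamma0AwayCharacterExtensionProofs.lean`):

* the abstract amalgam `P = Γ₀(N) *_{Γ₀(3N)} Γ₀(N)` is Mathlib's `Monoid.PushoutI` over `Bool` along
  `Gamma0.degeneracyConj N (3N) 1` (inclusion) and `Gamma0.degeneracyConj N (3N) 3`, both injective
  (`Gamma0Away.amalgamMaps_injective`); it maps to `SL₂(ℤ[1/3])` by `ψ = (ι, θ ∘ ι)`, `θ = Gamma0Away.theta 3 =
  Ad(diag(3,1)⁻¹)`, well defined by `Gamma0Away.theta_map_degeneracyConj`;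
* PING-PONG (`Gamma0AwayPingPong.lean`: `not_topHeavy_map`, `not_topHeavy_map_mul`, `topHeavy_theta_map_mul`,
  `topHeavy_map_mul_iff` w.r.t. the half-tree predicate `TopHeavy` and the `height`) feeds the abstract
  `Literature.GroupTheory.CombinatorialGroupTheory.Amalgam.exists_extension_of_pingPong`, which is stated for an
  ARBITRARY compatible pair of homomorphisms `f : ∀ b, G b →* M` — so the asymmetric pair `(φ₁, φ₂)` costs nothing;
* GENERATION `ψ(P) ⊇ Δ₃(N)` is `Gamma0Away.mem_of_apply_one_zero`.

The only new lemma is the dictionary `theta 3 (ι γ) = NineShiftEqualiser.kappa γ` (`theta_iota_eq_kappa`, by entries).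

## References
* J.-P. Serre, *Trees*, Springer (1980), Ch. I §4.1 Thm. 6; Ch. II §1.4 Thm. 3 and Cor. 1. [SerreTrees1980]
* B. Conrad, F. Diamond, R. Taylor, JAMS 12 (1999), p. 549 (level-`N` form).
-/

noncomputable section

-- every decl of this flat Theorems directory lives in `Summit.BirchSwinnertonDyer.BirchSwinnertonDyer.…` (summit = sub-problem)
set_option linter.dupNamespace false

open scoped MatrixGroups

open CongruenceSubgroup Monoid
open Literature.NumberTheory.EllipticCurves
open Literature.NumberTheory.EllipticCurves.ModularForms (Gamma0.degeneracyConj Gamma0.degeneracyConjElt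
  Gamma0.coe_degeneracyConj_one Gamma0.degeneracyConj_apply)
open Literature.NumberTheory.EllipticCurves.Gamma0Away
open Literature.GroupTheory.CombinatorialGroupTheory
open Summit.BirchSwinnertonDyer.BirchSwinnertonDyer.Theorems.ConjSpanGenAllLevels (Away iota Delta iota_apply)
open Summit.BirchSwinnertonDyer.Rank1Residual.ManinAdditive.NineShiftEqualiser (kappa g0Of slOf
  ThreeShiftAmalgamExtension ThreeShiftAmalgamExtensionAll ThreeShiftBasePrimeToThree
  threeShiftBasePrimeToThree_of_amalgam)

namespace Summit.BirchSwinnertonDyer.BirchSwinnertonDyer.Theorems.ManinLocalTwoThree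

/-! ### §1  Dictionary: the Literature's shift conjugation `θ` is the typer's `κ` -/

/-- `θ(ι γ) = κ(γ) = (a, b/3; 3c, d)`: the Literature's `Gamma0Away.theta 3 = Ad(diag(3,1)⁻¹)` on the image of
`SL₂(ℤ)` is the second vertex embedding `kappa` of `ThreeShiftBase.lean`. [folklore] -/
theorem theta_iota_eq_kappa (γ : SL(2, ℤ)) : theta 3 (iota 3 γ) = kappa γ := by
  ext i j
  fin_cases i <;> fin_cases j
  · rfl
  · show (iota 3 γ) 0 1 * IsLocalization.Away.invSelf (S := Localization.Away ((3 : ℕ) : ℤ)) ((3 : ℕ) : ℤ)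
        = ((γ 0 1 : ℤ) : Away 3) * IsLocalization.Away.invSelf (S := Away 3) ((3 : ℕ) : ℤ)
    rw [iota_apply]
  · show ((3 : ℕ) : Away 3) * (iota 3 γ) 1 0 = (3 : Away 3) * ((γ 1 0 : ℤ) : Away 3)
    rw [iota_apply]
    congr 1
  · rfl

/-! ### §2  E-es-107: Serre's amalgam, Hom-form, at every level prime to `3` -/

/-- **E-es-107 at one level** (`3 ∤ N`; the typed node also carries `0 < N`, not needed): a compatible pair of additive maps `φ₁, φ₂ : Γ₀(N) → K`
(`φ₁(a b; 3c d) = φ₂(a 3b; c d)`) is the pair of restrictions along `ι` and `κ` of a `Δ₃(N)`-additive map on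
`SL₂(ℤ[1/3])` — the universal property of Serre's amalgam `Γ₀(N; ℤ[1/3]) = Γ₀(N) *_{Γ₀(3N)} A₃⁻¹Γ₀(N)A₃` for
maps to abelian groups.  Proof = the Literature's tree-free proof of the symmetric case
(`gamma0Away_character_extension_of_shiftInvariant_holds`) with the pair `(u, u)` replaced by `(φ₁, φ₂)`.
[cite: SerreTrees1980, Ch. I §4.1 Thm. 6, Ch. II §1.4 Thm. 3] -/
theorem threeShiftAmalgamExtension_holds {N : ℕ} (h3N : ¬ 3 ∣ N) :
    ThreeShiftAmalgamExtension N := by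
  intro K _ φ₁ φ₂ h₁ h₂ hcompat
  -- the amalgam data (`t = 3`, `L' = N`), verbatim from the Literature proof
  let φ : ∀ _ : Bool, Gamma0 (N * 3) →* Gamma0 N := fun b =>
    cond b (Gamma0.degeneracyConj N (N * 3) 3 dvd_rfl)
      (Gamma0.degeneracyConj N (N * 3) 1 (mul_dvd_mul_left N (one_dvd 3)))
  have hφ : ∀ b, Function.Injective (φ b) := amalgamMaps_injective 3 N
  let ιΓ : Gamma0 N →* SL(2, Localization.Away ((3 : ℕ) : ℤ)) :=
    (Matrix.SpecialLinearGroup.map (Int.castRingHom (Localization.Away ((3 : ℕ) : ℤ)))).comp (Gamma0 N).subtype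
  let ιΓ' : Gamma0 (N * 3) →* SL(2, Localization.Away ((3 : ℕ) : ℤ)) :=
    (Matrix.SpecialLinearGroup.map (Int.castRingHom (Localization.Away ((3 : ℕ) : ℤ)))).comp
      (Gamma0 (N * 3)).subtype
  let f : ∀ _ : Bool, Gamma0 N →* SL(2, Localization.Away ((3 : ℕ) : ℤ)) := fun b =>
    cond b ((theta 3).comp ιΓ) ιΓ
  have hf : ∀ b, (f b).comp (φ b) = ιΓ' := by
    intro b
    cases b
    · ext γ : 1
      show Matrix.SpecialLinearGroup.map (Int.castRingHom (Localization.Away ((3 : ℕ) : ℤ)))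
          ((Gamma0.degeneracyConj N (N * 3) 1 (mul_dvd_mul_left N (one_dvd 3)) γ : Gamma0 N) : SL(2, ℤ))
        = Matrix.SpecialLinearGroup.map (Int.castRingHom (Localization.Away ((3 : ℕ) : ℤ))) (γ : SL(2, ℤ))
      rw [Gamma0.coe_degeneracyConj_one]
    · ext γ : 1
      exact theta_map_degeneracyConj 3 N γ
  let ψ : PushoutI φ →* SL(2, Localization.Away ((3 : ℕ) : ℤ)) := PushoutI.lift f ιΓ' hf
  have hψ_false : ∀ γ : Gamma0 N, ψ (PushoutI.of (φ := φ) false γ) =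
      Matrix.SpecialLinearGroup.map (Int.castRingHom (Localization.Away ((3 : ℕ) : ℤ))) (γ : SL(2, ℤ)) :=
    fun γ => by simp [ψ, f, ιΓ]
  have hψ_true : ∀ γ : Gamma0 N, ψ (PushoutI.of (φ := φ) true γ) =
      theta 3 (Matrix.SpecialLinearGroup.map (Int.castRingHom (Localization.Away ((3 : ℕ) : ℤ)))
        (γ : SL(2, ℤ))) :=
    fun γ => by simp [ψ, f, ιΓ]
  have hψ_base : ∀ c : Gamma0 (N * 3), ψ (PushoutI.base φ c) =
      Matrix.SpecialLinearGroup.map (Int.castRingHom (Localization.Away ((3 : ℕ) : ℤ))) (c : SL(2, ℤ)) :=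
    fun c => by simp [ψ, ιΓ']
  -- the two characters, as homomorphisms to `Multiplicative K`
  let f₁ : Gamma0 N →* Multiplicative K :=
    MonoidHom.mk' (fun γ => Multiplicative.ofAdd (φ₁ γ)) fun γ δ => by
      simp only [h₁ γ δ, ofAdd_add]
  let f₂ : Gamma0 N →* Multiplicative K :=
    MonoidHom.mk' (fun γ => Multiplicative.ofAdd (φ₂ γ)) fun γ δ => by
      simp only [h₂ γ δ, ofAdd_add]
  have hf₁ : ∀ γ, f₁ γ = Multiplicative.ofAdd (φ₁ γ) := fun γ => rfl
  have hf₂ : ∀ γ, f₂ γ = Multiplicative.ofAdd (φ₂ γ) := fun γ => rfl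
  let f' : ∀ b : Bool, Gamma0 N →* Multiplicative K := fun b => cond b f₂ f₁
  have hf' : ∀ b, (f' b).comp (φ b) = f₁.comp (φ false) := by
    intro b
    cases b
    · rfl
    · ext γ : 1
      simp only [MonoidHom.comp_apply, f', φ, cond_true, cond_false, hf₁, hf₂]
      -- compatibility on `Γ₀(3N)`: `γ = (a b; 3c d)`, `δ₁ γ = (a b; 3c d)`, `δ₃ γ = (a 3b; c d)`
      have h3dvd : (3 : ℤ) ∣ (γ : SL(2, ℤ)) 1 0 := by
        have hγ := γ.2
        rw [Gamma0_mem] at hγ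
        exact dvd_trans (by push_cast; exact dvd_mul_left _ _) ((ZMod.intCast_zmod_eq_zero_iff_dvd _ _).mp hγ)
      have hNdvd : ((N * 3 : ℕ) : ℤ) ∣ (γ : SL(2, ℤ)) 1 0 := by
        have hγ := γ.2
        rw [Gamma0_mem] at hγ
        exact (ZMod.intCast_zmod_eq_zero_iff_dvd _ _).mp hγ
      set a : ℤ := (γ : SL(2, ℤ)) 0 0 with ha
      set b : ℤ := (γ : SL(2, ℤ)) 0 1 with hb
      set c : ℤ := (γ : SL(2, ℤ)) 1 0 / 3 with hc
      set d : ℤ := (γ : SL(2, ℤ)) 1 1 with hd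
      have h3c : 3 * c = (γ : SL(2, ℤ)) 1 0 := Int.mul_ediv_cancel' h3dvd
      have hdet : a * d - b * (3 * c) = 1 := by
        have := Matrix.det_fin_two ((γ : SL(2, ℤ)) : Matrix (Fin 2) (Fin 2) ℤ)
        rw [(γ : SL(2, ℤ)).det_coe] at this
        rw [h3c]
        exact this.symm
      have hNc : (N : ℤ) ∣ c := by
        obtain ⟨k, hk⟩ := hNdvd
        refine ⟨k, ?_⟩
        have h3 : (3 : ℤ) ≠ 0 := by norm_num
        apply mul_left_cancel₀ h3
        rw [h3c, hk]; push_cast; ring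
      have e₁ : (Gamma0.degeneracyConj N (N * 3) 1 (mul_dvd_mul_left N (one_dvd 3)) γ : Gamma0 N)
          = g0Of a b (3 * c) d hdet (Dvd.dvd.mul_left hNc 3) := by
        apply Subtype.ext
        ext i j
        rw [Gamma0.coe_degeneracyConj_one]
        fin_cases i <;> fin_cases j
        · rfl
        · rfl
        · exact h3c.symm
        · rfl
      have e₂ : (Gamma0.degeneracyConj N (N * 3) 3 dvd_rfl γ : Gamma0 N)
          = g0Of a (3 * b) c d (by linear_combination hdet) hNc := by
        apply Subtype.ext
        ext i j
        rw [Gamma0.degeneracyConj_apply]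
        fin_cases i <;> fin_cases j <;> rfl
      rw [e₁, e₂, hcompat a b c d hdet hNc]
  -- the ping-pong hypotheses (verbatim from the Literature proof, `t = 3`, `L' = N`)
  obtain ⟨Φ, hmul, hof, -⟩ := Amalgam.exists_extension_of_pingPong hφ ψ {g | TopHeavy 3 g} (height 3)
    (fun γ => by
      rw [hψ_false]
      exact ⟨not_topHeavy_map 3 _, by rw [height_map, height_one]⟩)
    (fun γ hγ x hx => by
      rw [hψ_false]
      refine not_topHeavy_map_mul 3 _ (fun hd => hγ ?_) hx
      exact mem_range_inclusion_of_dvd 3 N h3N γ hd)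
    (fun γ hγ x hx => by
      rw [hψ_true]
      refine topHeavy_theta_map_mul 3 _ (fun hd => hγ ?_) hx
      exact mem_range_degeneracyConj_of_dvd 3 N γ hd)
    (fun c x => by
      rw [hψ_base]
      refine topHeavy_map_mul_iff 3 _ ?_ x
      have hc := c.2
      rw [Gamma0_mem] at hc
      exact dvd_trans (by push_cast; exact dvd_mul_left _ _) ((ZMod.intCast_zmod_eq_zero_iff_dvd _ _).mp hc))
    (fun γ hγ => by
      rw [hψ_false] at hγ
      have := map_injective 3 (hγ.trans (map_one _).symm)
      exact Subtype.ext this)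
    f' (f₁.comp (φ false)) hf'
  -- generation: `Γ₀(N; ℤ[1/3]) ⊆ ψ(P)`
  have hS : ∀ γ : SL(2, ℤ), γ ∈ Gamma0 N →
      Matrix.SpecialLinearGroup.map (Int.castRingHom (Localization.Away ((3 : ℕ) : ℤ))) γ ∈ ψ.range :=
    fun γ hγ => ⟨PushoutI.of (φ := φ) false ⟨γ, hγ⟩, hψ_false ⟨γ, hγ⟩⟩
  have hS' : ∀ γ : SL(2, ℤ), γ ∈ Gamma0 N →
      theta 3 (Matrix.SpecialLinearGroup.map (Int.castRingHom (Localization.Away ((3 : ℕ) : ℤ))) γ)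
        ∈ ψ.range :=
    fun γ hγ => ⟨PushoutI.of (φ := φ) true ⟨γ, hγ⟩, hψ_true ⟨γ, hγ⟩⟩
  refine ⟨fun g => Multiplicative.toAdd (Φ g), ?_, ?_, ?_⟩
  · intro g hg g' hg'
    have hgm := mem_of_apply_one_zero 3 ψ.range hS hS' h3N g hg
    have hgm' := mem_of_apply_one_zero 3 ψ.range hS hS' h3N g' hg'
    show Multiplicative.toAdd (Φ (g * g')) = Multiplicative.toAdd (Φ g) + Multiplicative.toAdd (Φ g')
    rw [hmul g hgm g' hgm', toAdd_mul]
  · intro γ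
    have := hof false γ
    rw [hψ_false] at this
    show Multiplicative.toAdd (Φ _) = _
    rw [this]
    rfl
  · intro γ
    have := hof true γ
    rw [hψ_true, theta_iota_eq_kappa] at this
    show Multiplicative.toAdd (Φ _) = _
    rw [this]
    rfl

/-- **E-es-107 PROVED** (`NineShiftEqualiser.ThreeShiftAmalgamExtensionAll`): Serre's amalgam for
`Γ₀(N; ℤ[1/3])`, Hom-form, at every level `N ≥ 1` prime to `3`. [cite: SerreTrees1980, Ch. II §1.4 Thm. 3] -/
theorem threeShiftAmalgamExtensionAll_holds : ThreeShiftAmalgamExtensionAll :=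
  fun _ _ h3N => threeShiftAmalgamExtension_holds h3N

/-! ### §3  E-es-102: the t = 3 base of the fine reduction, unconditionally -/

/-- **E-es-102 PROVED** (`NineShiftEqualiser.ThreeShiftBasePrimeToThree` = THEOREM II(t = 3) of the es fine
reduction): for every `N₀ ≥ 1` with `3 ∤ N₀`, every additive 3-shift-invariant `φ : Γ₀(N₀) → ℤ/3` is a diamond
character and every additive 3-shift-anti-invariant `ψ : Γ₀(N₀) → ℤ/3` vanishes — by the typer's edge
`threeShiftBasePrimeToThree_of_amalgam` (cube-root trick + the tree's Vaserstein diamond bottom) from E-es-107.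
This discharges the binder `(hbase : ThreeShiftBasePrimeToThree)` of `NineShiftFineReduction.fine_reduction`,
`NineShiftConjDefect.conjDefectLawNine_of_fine` / `not_three_dvd_maninConstant_of_fine` and
`ManinLocalTwoThree.antiInvariantTrivialAt_nine`. [folklore] -/
theorem threeShiftBasePrimeToThree_holds : ThreeShiftBasePrimeToThree :=
  threeShiftBasePrimeToThree_of_amalgam threeShiftAmalgamExtensionAll_holds

end Summit.BirchSwinnertonDyer.BirchSwinnertonDyer.Theorems.ManinLocalTwoThree

end
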